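import Summits.QuantumFields.BalabanUV.Beta.D1BFx.SbpScalarEnd
import Summits.QuantumFields.BalabanUV.Beta.D1BFx.RoadEndPinned

/-!
# `BalabanUV.Beta.D1BFx.SbpScalarEndMean` — road «BF-x» for binder row D1, row «C3-SBP», MEAN LANE ROOT: THE MEAN-GRADING ROAD ENDS
# (`ShellRoadEndMean`) WITH THE SHELL ROWS `h2s` ∕ `d2s` DELETED — the base-point-averaged table side drifts by itself from the FOUR first-order
# rows `h0` ∕ `h1` ∕ `d0` ∕ `d1` alone, through the owner's summation-by-parts A₁-form `SbpShellRemainder.sbp_A1`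

HONEST DEPENDENCY (page 1, mandatory): continuum YM on T⁴ ⇐ BetaPertH ∧ nine spine estimates (0/9 proved); BetaPertH ⇐ (D1) ∧ (D4) ∧
CAP+tail; G-an2-4 gates asym, D1 and NE2/3/4.  HONEST FRAMING (cell contract, verbatim): «discharging `BetaPertH` makes Bałaban's UV
stability UNCONDITIONAL — a real constructive-QFT result; it is NOT the continuum limit and NOT the Clay problem.»  THIS MODULE DISCHARGES
NOTHING of the wall: [folklore] sequence algebra copied VERBATIM from leaf-03's `ShellRoadEndMean` (p-tree, gen 5: `tableSide_drift_shell` ∕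
`d1Drift_of_meanRoad_table_shell` ∕ `d1Drift_JsBalAn1Ctr_of_meanRoad_table_pinned_shell`) with leaf-07's shell wall
`ShellGradedRoad.oneLoopDrift_of_scalarShellBounds_avg` replaced BY NAME by the OWNER d1-p2's summation-by-parts A₁-form `SbpShellRemainder.sbp_A1`
(PART 3 of «C3-SBP») and leaf-07's `ShellWindowInterface.oneLoopDrift_of_windowSumPow_identity` — exactly as the owner's PART 4
`SbpScalarEnd.d1Drift_of_strongRoad_sbp` does for the strong grading.  Every binder is a HYPOTHESIS with free constants; no `def`, no `Prop`
mirror, no cited fact, 0 sorry; 0 wall binders instantiated; NOT D1, NOT `BetaPertH`, NOT continuum, NOT Clay.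

ABSOLUTE RULE (cell charter, verbatim): «No internally-minted statement may enter as a cited fact. Every hypothesis is either kernel-proved in
this package or a verbatim quotation of a PUBLISHED theorem with page reference. The manuscript(s) under audit are NOT citable for their own
disputed steps — they are the thing under adjudication; programme-internal (2001/route/tribunal) claims are never citable.»

WHY (owner d1-p2 gen 13, «C3-SBP» RESULT + OFFER, journal 2026-08-21 l.35219; `LEAVES-BFx.md` INTEGRATION #35 ∕ row «C3-SBP»): every END of road
BF-x displays the two shell-ℓ¹ mixed-second-difference rows `h2s` ∕ `d2s` of the frozen profile; the owner's PARTs 1–4 (`SbpShellAlgebra` ∕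
`SbpShellTerm` ∕ `SbpShellRemainder` ∕ `SbpScalarEnd`) show the scalar wall never needed them (one Abel summation over `ℤ⁴` moves the only
second difference of the correction onto the weight, leaving first-order rows), and give the STRONG-grading END without them.  THIS FILE is
the first of the offered twins for the MEAN lane (`RoadEnd` §4 ∕ `RoadEndPinned` ∕ `RoadEndRowPinned` ∕ `RoadEndBFxTotalMeanShell(S)` ∕
`RoadEndBFxRecutMeanShell(S)` ∕ `RoadEndBFxWiredMeanS` ∕ `RoadEndBFxD1SumMeanS`): the mean-grading road ends of `ShellRoadEndMean` with
`h2s` ∕ `d2s` struck, every other binder character for character.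

CONTENT (all [folklore]; `d = 4`, `μ ≠ ν`, `Lc ≥ 2`).
* `tableSide_drift_sbp` — `ShellRoadEndMean.tableSide_drift_shell` minus `h2s` ∕ `d2s`: the base-point-averaged table side
  `F n := Σ_{b ∈ Bset n} wt n b · fullSum (stK μ ν N (Gf n b))` satisfies `|F (Lc^m) − F (Lc^0) − stepBal N Lc · m| ≤ A'` for all `m`, from
  `h0` ∕ `h1` ∕ `d0` ∕ `d1` only (`sbp_A1` at every `n ≥ 2`, convexity over `b`, then `oneLoopDrift_of_windowSumPow_identity` at the
  TAUTOLOGICAL split `incr j := F (Lc^(j+1)) − F (Lc^j)`).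
* `d1Drift_of_meanRoad_table_sbp` — `ShellRoadEndMean.d1Drift_of_meanRoad_table_shell` minus `h2s` ∕ `d2s` (any `Js`; all-scales bound,
  Cesàro-null B1, mean target, rows `h0` ∕ `h1` ∕ `d0` ∕ `d1`) ⟹ `D1Drift Lc Js N μ ν`.
* `d1Drift_JsBalAn1Ctr_of_meanRoad_table_pinned_sbp` — `ShellRoadEndMean.d1Drift_JsBalAn1Ctr_of_meanRoad_table_pinned_shell` minus `h2s` ∕ `d2s`
  (the road's literal at the pin; the all-scales binder is gan24-p1's theorem `allScalesSeq_secondMoment_JsBalAn1Ctr_pinned`).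
Unit `b2b-balaban-gan24-formalise-leaf-05` (gen 46), G-an2-4 swarm leaf prover on the D1 formalisation swarm's road «BF-x» (owner OFFER l.35219,
mean lane; first refusal leaf-01 honoured by hold-off); `LEAVES-BFx.md` row «C3-SBP», sub-row «MEAN LANE».
-/

noncomputable section

open Finset Filter Topology
open scoped BigOperators
open Literature.Probability.LatticeModels (annulus)
open Literature.MathematicalPhysics.QuantumFieldTheory.Balaban1983to89
open Literature.MathematicalPhysics.QuantumFieldTheory.Balaban1983to89.Beta
open RemainderConstAllScales (AllScalesSeq)
open OneStepResolventKernel (JetData)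
open OneStepKernelFamily (TbalOf D1Drift)
open MarginalTelescoping (composedCoeff IdentityForm)
open WindowIdentification (fullSum)
open DyadicShell (Pt toReal supNorm)
open SquareTable (stK bfCoeff bfP bfQ hdeg_bf hval_bf)
open GhostTable (gFree)
open BubbleTransfer (unitVec lattBubble)
open TwoPowerLegs (free freeMixedLeg)
open ScalewiseVectorSeam (splitOf)
open Summit.QuantumFields.BalabanUV.Beta.MixedJetTablesPlug (JsBalAn1Ctr)
open Summit.QuantumFields.BalabanUV.Beta.GAN24.StencilSlotOfE3 (one_le_of_two_le)
open Summit.QuantumFields.BalabanUV.Beta.GAN24.WSlotT2TablesAn1 (allScalesSeq_secondMoment_JsBalAn1Ctr_pinned)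
open Summit.QuantumFields.BalabanUV.Beta.D1BFx.SbpShellRemainder (sbp_A1)
open Summit.QuantumFields.BalabanUV.Beta.D1BFx.SbpScalarEnd (stK_free_eq_lattBubble gFree_facts)
open Summit.QuantumFields.BalabanUV.Beta.D1BFx.RoadEnd (d1Drift_of_meanRoad)

namespace Summit.QuantumFields.BalabanUV.Beta.D1BFx.SbpScalarEndMean

variable {Lc : ℕ} [NeZero Lc] {κB : Type*}

omit [NeZero Lc] in
/-- [folklore] **THE BASE-POINT-AVERAGED TABLE SIDE DRIFTS BY ITSELF — FROM FIRST-ORDER ROWS ONLY.**  `ShellRoadEndMean.tableSide_drift_shell`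
with the shell rows `h2s` ∕ `d2s` DELETED: for convex base-point weights and profiles `Gf n b` obeying `h0` (`|Gf − gFree| ≤ D₀/n²`), `h1`
(`|F_ρ(Gf − gFree)| ≤ D₁/n³`) everywhere and `d0` (`|Gf| ≤ A₀e^{−(δ/n)‖v‖}/‖v‖²`), `d1` (`|F_ρ Gf| ≤ A₁e^{−(δ/n)‖v‖}/‖v‖³`) off the origin,
the averaged table side `F n := Σ_{b ∈ Bset n} wt n b · fullSum (stK μ ν N (Gf n b))` satisfies `|F (Lc^m) − F (Lc^0) − stepBal N Lc · m| ≤ A'`.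
PROOF: the owner's A₁-form `SbpShellRemainder.sbp_A1` (n-uniform, NO second-difference row) at every `n ≥ 2`, convexity over `b` (PART 4's
`havg` block verbatim), then leaf-07's `ShellWindowInterface.oneLoopDrift_of_windowSumPow_identity` on the realised table (`hdeg_bf`, `hval_bf`,
`SbpScalarEnd.stK_free_eq_lattBubble`) at the TAUTOLOGICAL split `incr j := F (Lc^(j+1)) − F (Lc^j)` (`IdentityForm` by `rfl`, carrier
`splitOf incr`, window cut-off `M n := n`, `cc := 1`). -/
theorem tableSide_drift_sbp {μ ν : Fin 4} (hμν : μ ≠ ν) {N : ℝ} (hN : N ≠ 0) (hL : 2 ≤ Lc)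
    {Bset : ℕ → Finset κB} {wt : ℕ → κB → ℝ} {Gf : ℕ → κB → Pt → ℝ} {D A : ℕ → ℝ}
    (hD : ∀ j, 0 ≤ D j) (hA : ∀ j, 0 ≤ A j) {δ : ℝ} (hδ : 0 < δ)
    (hwt0 : ∀ n : ℕ, 2 ≤ n → ∀ b ∈ Bset n, 0 ≤ wt n b) (hwt1 : ∀ n : ℕ, 2 ≤ n → ∑ b ∈ Bset n, wt n b = 1)
    (h0 : ∀ n : ℕ, 2 ≤ n → ∀ b ∈ Bset n, ∀ v, |Gf n b v - gFree v| ≤ D 0 / (n : ℝ) ^ 2)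
    (h1 : ∀ n : ℕ, 2 ≤ n → ∀ b ∈ Bset n, ∀ v (ρ : Fin 4),
      |(Gf n b (v + unitVec ρ) - gFree (v + unitVec ρ)) - (Gf n b v - gFree v)| ≤ D 1 / (n : ℝ) ^ 3)
    (d0 : ∀ n : ℕ, 2 ≤ n → ∀ b ∈ Bset n, ∀ v : Pt, v ≠ 0 → |Gf n b v| ≤ A 0 * Real.exp (-(δ / n) * supNorm v) / (supNorm v : ℝ) ^ 2)
    (d1 : ∀ n : ℕ, 2 ≤ n → ∀ b ∈ Bset n, ∀ v : Pt, v ≠ 0 → ∀ ρ : Fin 4,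
      |Gf n b (v + unitVec ρ) - Gf n b v| ≤ A 1 * Real.exp (-(δ / n) * supNorm v) / (supNorm v : ℝ) ^ 3) :
    ∃ A' : ℝ, ∀ m : ℕ,
      |(∑ b ∈ Bset (Lc ^ m), wt (Lc ^ m) b * fullSum (stK μ ν N (Gf (Lc ^ m) b)))
          - (∑ b ∈ Bset (Lc ^ 0), wt (Lc ^ 0) b * fullSum (stK μ ν N (Gf (Lc ^ 0) b)))
          - B12Normalization.stepBal N Lc * m| ≤ A' := by
  classical
  obtain ⟨hgU, hg2, hg3, hg4⟩ := gFree_facts hμν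
  set U0 := free.U
  set C2 := free.baseLeg.A + free.baseLeg.B with hC2d
  set C3 := ∑ ρ' : Fin 4, ((free.fwdLeg ρ').A + (free.fwdLeg ρ').B) with hC3d
  set C4 := (freeMixedLeg hμν).A + (freeMixedLeg hμν).B with hC4d
  have hU0 : 0 ≤ U0 := free.nonneg_U
  have hC2 : 0 ≤ C2 := add_nonneg free.baseLeg.nonneg_A free.baseLeg.nonneg_B
  have hC3 : 0 ≤ C3 := Finset.sum_nonneg fun ρ' _ => add_nonneg (free.fwdLeg ρ').nonneg_A (free.fwdLeg ρ').nonneg_B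
  have hC4 : 0 ≤ C4 := add_nonneg (freeMixedLeg hμν).nonneg_A (freeMixedLeg hμν).nonneg_B
  set A1c : ℝ := 1600 * N ^ 2 * D 1 * (4 * (U0 + C2) + D 0 + 8 * (2 * U0 + C3) + D 1) +
    1600 * N ^ 2 * (C4 * D 0 + D 1 * (16 * U0 + 9 * C3) + D 1 * D 1) +
    80 * (20 * N ^ 2 * Real.exp δ * (4 * A 0 + 8 * A 1) * (8 * A 1 + C3) + Real.exp δ * N ^ 2 * (80 * A 0 * C4 + 1280 * A 1 ^ 2)) *
      (1 + 1 / δ) with hA1c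
  -- the table side and its increments along the scales
  set F : ℕ → ℝ := fun n => ∑ b ∈ Bset n, wt n b * fullSum (stK μ ν N (Gf n b)) with hF
  set incr : ℕ → ℝ := fun j => F (Lc ^ (j + 1)) - F (Lc ^ j) with hincr
  have hsum : ∀ m : ℕ, ∑ j ∈ range m, incr j = F (Lc ^ m) - F (Lc ^ 0) := fun m =>
    Finset.sum_range_sub (fun j => F (Lc ^ j)) m
  have hid : IdentityForm (fun j _ => incr j) (splitOf incr).β0 := fun _ _ _ => rfl
  have hcomp : ∀ m, composedCoeff (fun j _ => incr j) m = ∑ j ∈ range m, incr j := fun _ => rfl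
  -- the owner's A₁-form at every blocking factor `n ≥ 2`, averaged over the base points (convexity)
  have havg : ∀ n : ℕ, 2 ≤ n → |F n - ∑ w ∈ annulus 4 0 n, stK μ ν N gFree w| ≤ A1c := by
    intro n hn
    set Y := ∑ w ∈ annulus 4 0 n, stK μ ν N gFree w
    have hbnd : ∀ b ∈ Bset n, |fullSum (stK μ ν N (Gf n b)) - Y| ≤ A1c := fun b hb =>
      sbp_A1 hμν N hn (Gf n b) gFree hU0 hC2 hC3 hC4 (hD 0) (hD 1) (hA 0) (hA 1) hδ hgU hg2 hg3 hg4 (h0 n hn b hb) (h1 n hn b hb)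
        (d0 n hn b hb) (d1 n hn b hb)
    have e : F n - Y = ∑ b ∈ Bset n, wt n b * (fullSum (stK μ ν N (Gf n b)) - Y) := by
      simp only [hF, mul_sub, Finset.sum_sub_distrib, ← Finset.sum_mul, hwt1 n hn, one_mul]
    rw [e]
    calc |∑ b ∈ Bset n, wt n b * (fullSum (stK μ ν N (Gf n b)) - Y)| ≤ ∑ b ∈ Bset n, |wt n b * (fullSum (stK μ ν N (Gf n b)) - Y)| :=
          Finset.abs_sum_le_sum_abs _ _
      _ ≤ ∑ b ∈ Bset n, wt n b * A1c := Finset.sum_le_sum fun b hb => by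
          rw [abs_mul, abs_of_nonneg (hwt0 n hn b hb)]
          exact mul_le_mul_of_nonneg_left (hbnd b hb) (hwt0 n hn b hb)
      _ = A1c := by rw [← Finset.sum_mul, hwt1 n hn, one_mul]
  -- the A₁-form of the increments against the realised table's window sum
  have hpow : ∀ m : ℕ, 1 ≤ m → 2 ≤ Lc ^ m := fun m hm => hL.trans (Nat.le_self_pow (by omega) Lc)
  have hA₁ : ∀ m : ℕ, 1 ≤ m → |composedCoeff (fun j _ => incr j) m -
      ∑ w ∈ annulus 4 0 ((fun n : ℕ => n) (Lc ^ m)), toReal w μ * toReal w ν * lattBubble Finset.univ (bfCoeff N) (bfP hμν) (bfQ hμν) (Lc ^ m) 0 w| ≤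
      |F (Lc ^ 0)| + A1c := by
    intro m hm
    rw [hcomp, hsum]
    have hY : ∑ w ∈ annulus 4 0 (Lc ^ m), toReal w μ * toReal w ν * lattBubble Finset.univ (bfCoeff N) (bfP hμν) (bfQ hμν) (Lc ^ m) 0 w =
        ∑ w ∈ annulus 4 0 (Lc ^ m), stK μ ν N gFree w := Finset.sum_congr rfl fun w _ => (stK_free_eq_lattBubble hμν N (Lc ^ m) 0 w).symm
    show |F (Lc ^ m) - F (Lc ^ 0) - ∑ w ∈ annulus 4 0 (Lc ^ m), toReal w μ * toReal w ν *
      lattBubble Finset.univ (bfCoeff N) (bfP hμν) (bfQ hμν) (Lc ^ m) 0 w| ≤ |F (Lc ^ 0)| + A1c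
    rw [hY]
    have e : F (Lc ^ m) - F (Lc ^ 0) - ∑ w ∈ annulus 4 0 (Lc ^ m), stK μ ν N gFree w =
        -F (Lc ^ 0) + (F (Lc ^ m) - ∑ w ∈ annulus 4 0 (Lc ^ m), stK μ ν N gFree w) := by ring
    rw [e]
    refine (abs_add_le _ _).trans (add_le_add ?_ (havg (Lc ^ m) (hpow m hm)))
    rw [abs_neg]
  have hc : (1 : ℝ) ≤ 1 := le_rfl
  have hM : ∀ L : ℕ, 2 ≤ L → 1 ≤ (fun n : ℕ => n) L ∧ (L : ℝ) ≤ 1 * ((fun n : ℕ => n) L : ℕ) := fun L hL2 =>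
    ⟨le_trans (by norm_num) hL2, by simp⟩
  have hML : ∀ L : ℕ, 2 ≤ L → (fun n : ℕ => n) L ≤ L := fun _ _ => le_rfl
  have hdrift := ShellWindowInterface.oneLoopDrift_of_windowSumPow_identity (splitOf incr) (hdeg_bf hμν) hμν hN (hval_bf hμν N) hL
    (μC := fun j _ => incr j) (M := fun n : ℕ => n) hc hM hML hA₁ hid
  obtain ⟨A', hA'⟩ : ∃ A' : ℝ, Drift.OneLoopDrift (B12Normalization.stepBal N Lc) A' incr := ⟨_, hdrift⟩
  refine ⟨A', fun m => ?_⟩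
  rw [← hsum]
  exact hA' m

/-- [folklore] **THE MEAN ROAD END IN THE TABLE CURRENCY — NO SECOND-DIFFERENCE ROW.**  `ShellRoadEndMean.d1Drift_of_meanRoad_table_shell` with the
shell rows `h2s` ∕ `d2s` DELETED: for ANY jet data `Js`, an all-scales bound (`0 ≤ θ < 1`), a CESÀRO-NULL telescoping defect against a one-shot
coefficient `c (Lc^m)`, the MEAN target `(c (Lc^m) − F (Lc^m))/m → 0` over a leg family `Gf`, and the rows `h0` ∕ `h1` ∕ `d0` ∕ `d1` ⟹
`D1Drift Lc Js N μ ν` (body verbatim, `tableSide_drift_shell ↦ tableSide_drift_sbp`). -/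
theorem d1Drift_of_meanRoad_table_sbp (Js : ℕ → JetData 3 Lc) {μ ν : Fin 4} (hμν : μ ≠ ν) {N : ℝ} (hN : N ≠ 0) (hL : 2 ≤ Lc) {κ θ : ℝ}
    (hall : AllScalesSeq (fun j => B12Beta.secondMoment (TbalOf Lc Js j) μ ν) κ θ) (hθ0 : 0 ≤ θ) (hθ1 : θ < 1)
    (c : ℕ → ℝ) {Bset : ℕ → Finset κB} {wt : ℕ → κB → ℝ} {Gf : ℕ → κB → Pt → ℝ} {D A : ℕ → ℝ}
    (hD : ∀ j, 0 ≤ D j) (hA : ∀ j, 0 ≤ A j) {δ : ℝ} (hδ : 0 < δ)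
    (hwt0 : ∀ n : ℕ, 2 ≤ n → ∀ b ∈ Bset n, 0 ≤ wt n b) (hwt1 : ∀ n : ℕ, 2 ≤ n → ∑ b ∈ Bset n, wt n b = 1)
    (h0 : ∀ n : ℕ, 2 ≤ n → ∀ b ∈ Bset n, ∀ v, |Gf n b v - gFree v| ≤ D 0 / (n : ℝ) ^ 2)
    (h1 : ∀ n : ℕ, 2 ≤ n → ∀ b ∈ Bset n, ∀ v (ρ : Fin 4),
      |(Gf n b (v + unitVec ρ) - gFree (v + unitVec ρ)) - (Gf n b v - gFree v)| ≤ D 1 / (n : ℝ) ^ 3)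
    (d0 : ∀ n : ℕ, 2 ≤ n → ∀ b ∈ Bset n, ∀ v : Pt, v ≠ 0 → |Gf n b v| ≤ A 0 * Real.exp (-(δ / n) * supNorm v) / (supNorm v : ℝ) ^ 2)
    (d1 : ∀ n : ℕ, 2 ≤ n → ∀ b ∈ Bset n, ∀ v : Pt, v ≠ 0 → ∀ ρ : Fin 4,
      |Gf n b (v + unitVec ρ) - Gf n b v| ≤ A 1 * Real.exp (-(δ / n) * supNorm v) / (supNorm v : ℝ) ^ 3)
    (hB1 : Tendsto (fun m : ℕ => ((∑ j ∈ range m, B12Beta.secondMoment (TbalOf Lc Js j) μ ν) - c (Lc ^ m)) / (m : ℝ)) atTop (𝓝 0))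
    (hT : Tendsto (fun m : ℕ => (c (Lc ^ m) - ∑ b ∈ Bset (Lc ^ m), wt (Lc ^ m) b * fullSum (stK μ ν N (Gf (Lc ^ m) b))) / (m : ℝ))
      atTop (𝓝 0)) :
    D1Drift Lc Js N μ ν := by
  set F : ℕ → ℝ := fun n => ∑ b ∈ Bset n, wt n b * fullSum (stK μ ν N (Gf n b)) with hF
  set s : ℝ := B12Normalization.stepBal N Lc with hs
  obtain ⟨A', hA'⟩ := tableSide_drift_sbp hμν hN hL hD hA hδ hwt0 hwt1 h0 h1 d0 d1
  have hF0 : Tendsto (fun m : ℕ => (F (Lc ^ m) - F (Lc ^ 0) - s * m) / (m : ℝ)) atTop (𝓝 0) := by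
    refine squeeze_zero_norm' ?_ (tendsto_const_div_atTop_nhds_zero_nat A')
    filter_upwards [eventually_ge_atTop 1] with m hm
    have hmpos : (0 : ℝ) < m := by exact_mod_cast hm
    rw [Real.norm_eq_abs, abs_div, abs_of_pos hmpos]
    exact div_le_div_of_nonneg_right (hA' m) hmpos.le
  have hF1 : Tendsto (fun m : ℕ => F (Lc ^ 0) / (m : ℝ)) atTop (𝓝 0) := tendsto_const_div_atTop_nhds_zero_nat _
  have hFm : Tendsto (fun m : ℕ => F (Lc ^ m) / (m : ℝ)) atTop (𝓝 s) := by
    have h := (hF0.add hF1).add (tendsto_const_nhds (x := s))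
    rw [zero_add, zero_add] at h
    refine h.congr' ?_
    filter_upwards [eventually_ge_atTop 1] with m hm
    have hmne : (m : ℝ) ≠ 0 := by exact_mod_cast (Nat.one_le_iff_ne_zero.mp hm)
    field_simp
    ring
  have hcm : Tendsto (fun m : ℕ => c (Lc ^ m) / (m : ℝ)) atTop (𝓝 s) := by
    have h := hT.add hFm
    rw [zero_add] at h
    refine h.congr' (Eventually.of_forall fun m => ?_)
    simp only [hF, sub_div, sub_add_cancel]
  exact d1Drift_of_meanRoad Js hall hθ0 hθ1 N c hB1 hcm

/-- [folklore] **THE MEAN ROAD END FOR THE ROAD'S LITERAL AT THE PIN, TABLE CURRENCY — NO SECOND-DIFFERENCE ROW.**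
`ShellRoadEndMean.d1Drift_JsBalAn1Ctr_of_meanRoad_table_pinned_shell` with `h2s` ∕ `d2s` DELETED (the all-scales binder is gan24-p1's theorem
`allScalesSeq_secondMoment_JsBalAn1Ctr_pinned`). -/
theorem d1Drift_JsBalAn1Ctr_of_meanRoad_table_pinned_sbp (hLc : 2 ≤ Lc) (cE cVH cΛ cB : ℝ) (Tc : Fin 4 → Fin 4 → Fin 4 → Fin 4 → ℝ)
    {μ ν : Fin 4} (hμν : μ ≠ ν) {N : ℝ} (hN : N ≠ 0) (c : ℕ → ℝ) {Bset : ℕ → Finset κB} {wt : ℕ → κB → ℝ} {Gf : ℕ → κB → Pt → ℝ}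
    {D A : ℕ → ℝ} (hD : ∀ j, 0 ≤ D j) (hA : ∀ j, 0 ≤ A j) {δ : ℝ} (hδ : 0 < δ)
    (hwt0 : ∀ n : ℕ, 2 ≤ n → ∀ b ∈ Bset n, 0 ≤ wt n b) (hwt1 : ∀ n : ℕ, 2 ≤ n → ∑ b ∈ Bset n, wt n b = 1)
    (h0 : ∀ n : ℕ, 2 ≤ n → ∀ b ∈ Bset n, ∀ v, |Gf n b v - gFree v| ≤ D 0 / (n : ℝ) ^ 2)
    (h1 : ∀ n : ℕ, 2 ≤ n → ∀ b ∈ Bset n, ∀ v (ρ : Fin 4),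
      |(Gf n b (v + unitVec ρ) - gFree (v + unitVec ρ)) - (Gf n b v - gFree v)| ≤ D 1 / (n : ℝ) ^ 3)
    (d0 : ∀ n : ℕ, 2 ≤ n → ∀ b ∈ Bset n, ∀ v : Pt, v ≠ 0 → |Gf n b v| ≤ A 0 * Real.exp (-(δ / n) * supNorm v) / (supNorm v : ℝ) ^ 2)
    (d1 : ∀ n : ℕ, 2 ≤ n → ∀ b ∈ Bset n, ∀ v : Pt, v ≠ 0 → ∀ ρ : Fin 4,
      |Gf n b (v + unitVec ρ) - Gf n b v| ≤ A 1 * Real.exp (-(δ / n) * supNorm v) / (supNorm v : ℝ) ^ 3)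
    (hB1 : Tendsto (fun m : ℕ => ((∑ j ∈ range m,
        B12Beta.secondMoment (TbalOf Lc (JsBalAn1Ctr (one_le_of_two_le hLc) cE cVH cΛ ((Lc : ℝ) ^ (2 * (3 + 1))) cB Tc) j) μ ν) - c (Lc ^ m)) / (m : ℝ))
        atTop (𝓝 0))
    (hT : Tendsto (fun m : ℕ => (c (Lc ^ m) - ∑ b ∈ Bset (Lc ^ m), wt (Lc ^ m) b * fullSum (stK μ ν N (Gf (Lc ^ m) b))) / (m : ℝ))
      atTop (𝓝 0)) :
    D1Drift Lc (JsBalAn1Ctr (one_le_of_two_le hLc) cE cVH cΛ ((Lc : ℝ) ^ (2 * (3 + 1))) cB Tc) N μ ν := by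
  obtain ⟨κ, θ, hθ0, hθ1, hall⟩ := allScalesSeq_secondMoment_JsBalAn1Ctr_pinned hLc cE cVH cΛ cB Tc μ ν
  exact d1Drift_of_meanRoad_table_sbp _ hμν hN hLc hall hθ0 hθ1 c hD hA hδ hwt0 hwt1 h0 h1 d0 d1 hB1 hT

end Summit.QuantumFields.BalabanUV.Beta.D1BFx.SbpScalarEndMean

end
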